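import Literature.AlgebraicGeometry.Motives.UniversalHypersurfaceRegularLocusChart
import Literature.AlgebraicGeometry.Motives.UniversalHypersurfaceTotalSpacePoints
import HarnessLib

/-!
# The coefficient map `𝒴°(ℂ) → ℂ^N` is a `C^∞` submersion; the chart images contain the smooth fibres

Family `hodge`, layer `Literature/AlgebraicGeometry/Motives`; sequel of `UniversalHypersurfaceRegularLocusChart` (the explicit charts
`regChartFun n d i = (b', z/zᵢ)` of the regular locus `𝒴° = regularTotal ℂ n d` of the universal hypersurface) and of
`UniversalHypersurfaceTotalSpacePoints` (points of the smooth family `𝒴_U(ℂ)`). For the differential topology of degenerations on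
the complex manifold `𝒴°(ℂ)` (programme discharging `HodgeTheory/CyclicCoverNodalMeridianLocalMonodromyBound`) one needs, besides the
charts, that the base projection is a submersion in the vector-space coordinates `b ∈ ℂ^N`, and that every point `(b, [z])` with
`F_b` nonsingular and `F_b(z) = 0` is a point of `𝒴°(ℂ)`:

* §1 `baseCoordFun n d : S^d(ℂ) → ℂ^{DegIndex n d}` — the coordinates of the affine space of forms (values of the `a_m`); regular,
  injective, hence (`ComplexPointsRegularInjectiveChart`) a global `C^∞` chart of `S^d(ℂ) = (affineBase ℂ n d)(ℂ)` with bijective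
  differential (`bijective_mfderiv_baseCoordFun`);
* §2 `regCoeff = baseCoordFun ∘ π(ℂ)` and **`Q ↦ (b_m(Q))_m` is a `C^∞` submersion `𝒴°(ℂ) → ℂ^N`** (`contMDiffAt_regCoeff`,
  `surjective_mfderiv_regCoeff`: `π = regularFamily` is smooth, so `π(ℂ)` is a submersion, `ComplexPoints.surjective_mfderiv_map`);
* §3 `exists_mem_regChartDom_of_eval_eq_zero` — **for `b` with `Σ b_m x^m` nonsingular and `w ∈ ℂⁿ⁺¹` with `F_b(w₀,…,1ᵢ,…,w_n) = 0`
  there is `Q ∈ 𝒴°(ℂ)ᵢ` with `regCoeff Q = b` and affine coordinates `w`** (the point of the smooth family over `pointOfCoeffs b` with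
  homogeneous coordinates `[w₀ : … : 1 : … : w_n]`, `exists_point_of_mem_projZeroLocus_pointForm`, pushed into `𝒴°` by `totalToRegular`);
  in particular the smooth fibres of `b ↦` lie in the chart domains' images.

Everything is proved; the one definition (`baseCoordFun`) is concrete; no named facts.

## References

* [SGA1] A. Grothendieck, M. Raynaud, SGA 1, Exp. XII Prop. 3.1 (iv) (`f` smooth ⇒ `f^an` submersive).
* [SerreGAGA1956] J.-P. Serre, Géométrie algébrique et géométrie analytique, Ann. Inst. Fourier 6 (1956), §2 n°5–6.
* [VoisinHodgeII2003] C. Voisin, Hodge Theory and Complex Algebraic Geometry II (2003), §6.2.1.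
-/

noncomputable section

open CategoryTheory AlgebraicGeometry MvPolynomial TopologicalSpace Set
open scoped Manifold ContDiff
open Literature.AlgebraicGeometry.HodgeTheory Literature.NumberTheory.Transcendental

namespace Literature.AlgebraicGeometry.Motives.UniversalHypersurface

variable (n d : ℕ)

/-! ### §1 Coordinates of the affine space of forms -/

/-- **The coordinates of `S^d(ℂ) = Spec ℂ[a_m](ℂ)`**: the values `(P(a_m))_m` of the algebra map `ℂ[a_m] → ℂ` underlying the
point (`AlgPoints.toAlgHom`; `affineBase ℂ n d = specOver ℂ ℂ[a_m]`). [cite: SerreGAGA1956, §2 n°5] -/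
def baseCoordFun (P : ComplexPoints (affineBase ℂ n d)) : DegIndex n d → ℂ :=
  fun m => AlgPoints.toAlgHom (P : AlgPoints (specOver ℂ (CoeffRing ℂ n d)) ℂ) (X m)

/-- The coordinates are the values of the global regular functions `a_m`. [cite: SerreGAGA1956, §2 n°5] -/
theorem baseCoordFun_eq_evalOrZero (P : ComplexPoints (affineBase ℂ n d)) (m : DegIndex n d) :
    baseCoordFun n d P m =
      AlgPoints.evalOrZero ⊤ ((Scheme.ΓSpecIso (.of (CoeffRing ℂ n d))).inv (X m)) P := by
  set P' : AlgPoints (specOver ℂ (CoeffRing ℂ n d)) ℂ := P with hP'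
  have hPt : P'.pt ∈ (⊤ : (Spec (.of (CoeffRing ℂ n d))).Opens) := trivial
  change _ = AlgPoints.evalOrZero ⊤ ((Scheme.ΓSpecIso (.of (CoeffRing ℂ n d))).inv (X m)) P'
  rw [AlgPoints.evalOrZero_of_mem _ hPt]
  have h2 := AlgPoints.eval_ofAlgHom_top (AlgPoints.toAlgHom P')
  rw [AlgPoints.ofAlgHom_toAlgHom] at h2
  rw [h2 hPt, Iso.inv_hom_id_apply]
  rfl

/-- **A point of `S^d(ℂ)` is determined by its coordinates** (an algebra map out of `ℂ[a_m]` is determined by its values on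
the variables). [cite: SerreGAGA1956, §2 n°5] -/
theorem injective_baseCoordFun : Function.Injective (baseCoordFun n d) := by
  intro P P' h
  have halg : AlgPoints.toAlgHom (P : AlgPoints (specOver ℂ (CoeffRing ℂ n d)) ℂ) =
      AlgPoints.toAlgHom (P' : AlgPoints (specOver ℂ (CoeffRing ℂ n d)) ℂ) :=
    MvPolynomial.algHom_ext fun m => congrFun h m
  have hP := AlgPoints.ofAlgHom_toAlgHom (P : AlgPoints (specOver ℂ (CoeffRing ℂ n d)) ℂ)
  have hP' := AlgPoints.ofAlgHom_toAlgHom (P' : AlgPoints (specOver ℂ (CoeffRing ℂ n d)) ℂ)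
  rw [halg] at hP
  exact hP.symm.trans hP'

/-- The coordinates form a regular family on all of `S^d(ℂ)` (hypothesis shape of `ComplexPointsRegularInjectiveChart`).
[cite: SerreGAGA1956, §2 n°5] -/
theorem regular_baseCoordFun (m : DegIndex n d) :
    ∃ (U : (affineBase ℂ n d).left.Opens) (s : Γ((affineBase ℂ n d).left, U)),
      (Set.univ : Set (ComplexPoints (affineBase ℂ n d))) ⊆ {Q | Q.pt ∈ U} ∧
        ∀ Q ∈ (Set.univ : Set (ComplexPoints (affineBase ℂ n d))), baseCoordFun n d Q m = AlgPoints.evalOrZero U s Q :=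
  ⟨⊤, (Scheme.ΓSpecIso (.of (CoeffRing ℂ n d))).inv (X m), fun _ _ => trivial,
    fun Q _ => baseCoordFun_eq_evalOrZero n d Q m⟩

/-- **The coordinates are a global `C^∞` chart of `S^d(ℂ)` with bijective differential** (injective regular family of the right
cardinality; `ComplexPoints.bijective_mfderiv_of_regular_injOn`). [cite: SerreGAGA1956, §2 n°6] -/
theorem bijective_mfderiv_baseCoordFun (P : ComplexPoints (affineBase ℂ n d)) :
    haveI := locallyOfFiniteType_affineBase_hom ℂ n d
    haveI := smoothOfRelativeDimension_affineBase_hom ℂ n d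
    letI := ComplexPoints.chartedSpace (affineBase ℂ n d) (Fintype.card (DegIndex n d))
    Function.Bijective (mfderiv (𝓡 (2 * Fintype.card (DegIndex n d))) 𝓘(ℝ, DegIndex n d → ℂ) (baseCoordFun n d) P) := by
  haveI := locallyOfFiniteType_affineBase_hom ℂ n d
  haveI := smoothOfRelativeDimension_affineBase_hom ℂ n d
  exact ComplexPoints.bijective_mfderiv_of_regular_injOn isOpen_univ rfl (regular_baseCoordFun n d)
    (injective_baseCoordFun n d).injOn (Set.mem_univ P)

/-- The coordinates are `C^∞` on `S^d(ℂ)`. [cite: SerreGAGA1956, §2 n°6] -/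
theorem contMDiffAt_baseCoordFun (P : ComplexPoints (affineBase ℂ n d)) :
    haveI := locallyOfFiniteType_affineBase_hom ℂ n d
    haveI := smoothOfRelativeDimension_affineBase_hom ℂ n d
    letI := ComplexPoints.chartedSpace (affineBase ℂ n d) (Fintype.card (DegIndex n d))
    ContMDiffAt (𝓡 (2 * Fintype.card (DegIndex n d))) 𝓘(ℝ, DegIndex n d → ℂ) ∞ (baseCoordFun n d) P := by
  haveI := locallyOfFiniteType_affineBase_hom ℂ n d
  haveI := smoothOfRelativeDimension_affineBase_hom ℂ n d
  exact ComplexPoints.contMDiffAt_of_regular (e := Fintype.card (DegIndex n d)) isOpen_univ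
    (regular_baseCoordFun n d) (Set.mem_univ P)

/-! ### §2 The coefficient map of `𝒴°(ℂ)` is a submersion -/

/-- `regCoeff = baseCoordFun ∘ π(ℂ)` (`regPointHom_hom_eq_toAlgHom`). [cite: VoisinHodgeII2003, §6.2.1] -/
theorem regCoeff_eq_baseCoordFun_map (Q : ComplexPoints (regularTotal ℂ n d)) :
    regCoeff ℂ n d Q = baseCoordFun n d (AlgPoints.map (regularFamily ℂ n d) Q) := by
  funext m
  change (regPointHom ℂ n d Q).hom (X m) = _
  rw [regPointHom_hom_eq_toAlgHom]
  rfl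

/-- **`Q ↦ (b_m(Q))_m` is `C^∞` on `𝒴°(ℂ)`** (`d ≥ 1`). [cite: SerreGAGA1956, §2 n°5 (p. 9)] -/
theorem contMDiffAt_regCoeff (hd : 0 < d) (Q : ComplexPoints (regularTotal ℂ n d)) :
    haveI := locallyOfFiniteType_regularTotal_hom ℂ n d hd
    haveI := smoothOfRelativeDimension_regularTotal_hom ℂ n d hd
    letI := ComplexPoints.chartedSpace (regularTotal ℂ n d) (n + Fintype.card (DegIndex n d))
    ContMDiffAt (𝓡 (2 * (n + Fintype.card (DegIndex n d)))) 𝓘(ℝ, DegIndex n d → ℂ) ∞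
      (fun Q => regCoeff ℂ n d Q) Q := by
  haveI := locallyOfFiniteType_regularTotal_hom ℂ n d hd
  haveI := smoothOfRelativeDimension_regularTotal_hom ℂ n d hd
  haveI := locallyOfFiniteType_affineBase_hom ℂ n d
  haveI := smoothOfRelativeDimension_affineBase_hom ℂ n d
  letI := ComplexPoints.chartedSpace (regularTotal ℂ n d) (n + Fintype.card (DegIndex n d))
  letI := ComplexPoints.chartedSpace (affineBase ℂ n d) (Fintype.card (DegIndex n d))
  haveI := ComplexPoints.isManifold_real (regularTotal ℂ n d) (n + Fintype.card (DegIndex n d))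
  haveI := ComplexPoints.isManifold_real (affineBase ℂ n d) (Fintype.card (DegIndex n d))
  have h1 := ComplexPoints.contMDiff_map (n := n + Fintype.card (DegIndex n d))
    (m := Fintype.card (DegIndex n d)) (regularFamily ℂ n d) Q
  have h2 : ContMDiffAt (𝓡 (2 * (n + Fintype.card (DegIndex n d)))) 𝓘(ℝ, DegIndex n d → ℂ) ∞
      (baseCoordFun n d ∘ (AlgPoints.map (regularFamily ℂ n d) : _ → ComplexPoints (affineBase ℂ n d))) Q :=
    (contMDiffAt_baseCoordFun n d _).comp Q h1
  exact h2.congr_of_eventuallyEq (Filter.Eventually.of_forall fun Q' => regCoeff_eq_baseCoordFun_map n d Q')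

/-- **`Q ↦ (b_m(Q))_m` is a submersion `𝒴°(ℂ) → ℂ^N`** (`d ≥ 1`): its differential is onto at every point, being the
composite of the differential of `π(ℂ)` (onto: `π` is smooth, `ComplexPoints.surjective_mfderiv_map`) and of the coordinates of
`S^d(ℂ)` (bijective). [cite: SGA1, Exp. XII Prop. 3.1 (iv)] [cite: SerreGAGA1956, §2 n°6] -/
theorem surjective_mfderiv_regCoeff (hd : 0 < d) (Q : ComplexPoints (regularTotal ℂ n d)) :
    haveI := locallyOfFiniteType_regularTotal_hom ℂ n d hd
    haveI := smoothOfRelativeDimension_regularTotal_hom ℂ n d hd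
    letI := ComplexPoints.chartedSpace (regularTotal ℂ n d) (n + Fintype.card (DegIndex n d))
    Function.Surjective (mfderiv (𝓡 (2 * (n + Fintype.card (DegIndex n d)))) 𝓘(ℝ, DegIndex n d → ℂ)
      (fun Q => regCoeff ℂ n d Q) Q) := by
  haveI := locallyOfFiniteType_regularTotal_hom ℂ n d hd
  haveI := smoothOfRelativeDimension_regularTotal_hom ℂ n d hd
  haveI := locallyOfFiniteType_affineBase_hom ℂ n d
  haveI := smoothOfRelativeDimension_affineBase_hom ℂ n d
  haveI : Smooth (regularFamily ℂ n d).left := smooth_regularFamily_left ℂ n d hd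
  letI := ComplexPoints.chartedSpace (regularTotal ℂ n d) (n + Fintype.card (DegIndex n d))
  letI := ComplexPoints.chartedSpace (affineBase ℂ n d) (Fintype.card (DegIndex n d))
  haveI := ComplexPoints.isManifold_real (regularTotal ℂ n d) (n + Fintype.card (DegIndex n d))
  haveI := ComplexPoints.isManifold_real (affineBase ℂ n d) (Fintype.card (DegIndex n d))
  have hπ : MDifferentiableAt (𝓡 (2 * (n + Fintype.card (DegIndex n d)))) (𝓡 (2 * Fintype.card (DegIndex n d)))
      (AlgPoints.map (regularFamily ℂ n d) : ComplexPoints (regularTotal ℂ n d) → ComplexPoints (affineBase ℂ n d)) Q :=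
    (ComplexPoints.contMDiff_map (n := n + Fintype.card (DegIndex n d)) (m := Fintype.card (DegIndex n d))
      (regularFamily ℂ n d) Q).mdifferentiableAt (by simp)
  have hκ : MDifferentiableAt (𝓡 (2 * Fintype.card (DegIndex n d))) 𝓘(ℝ, DegIndex n d → ℂ) (baseCoordFun n d)
      (AlgPoints.map (regularFamily ℂ n d) Q) :=
    (contMDiffAt_baseCoordFun n d _).mdifferentiableAt (by simp)
  have hcomp : (fun Q => regCoeff ℂ n d Q) =
      baseCoordFun n d ∘ (AlgPoints.map (regularFamily ℂ n d) : _ → ComplexPoints (affineBase ℂ n d)) :=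
    funext fun Q' => regCoeff_eq_baseCoordFun_map n d Q'
  have hmf : mfderiv (𝓡 (2 * (n + Fintype.card (DegIndex n d)))) 𝓘(ℝ, DegIndex n d → ℂ) (fun Q => regCoeff ℂ n d Q) Q =
      (mfderiv (𝓡 (2 * Fintype.card (DegIndex n d))) 𝓘(ℝ, DegIndex n d → ℂ) (baseCoordFun n d)
        (AlgPoints.map (regularFamily ℂ n d) Q)).comp
      (mfderiv (𝓡 (2 * (n + Fintype.card (DegIndex n d)))) (𝓡 (2 * Fintype.card (DegIndex n d)))
        (AlgPoints.map (regularFamily ℂ n d) : _ → ComplexPoints (affineBase ℂ n d)) Q) := by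
    rw [hcomp]
    exact mfderiv_comp Q hκ hπ
  have hsurjπ : Function.Surjective
      (mfderiv (𝓡 (2 * (n + Fintype.card (DegIndex n d)))) (𝓡 (2 * Fintype.card (DegIndex n d)))
        (AlgPoints.map (regularFamily ℂ n d) : _ → ComplexPoints (affineBase ℂ n d)) Q) :=
    ComplexPoints.surjective_mfderiv_map (n := n + Fintype.card (DegIndex n d))
      (m := Fintype.card (DegIndex n d)) (regularFamily ℂ n d) Q
  have hbijκ : Function.Bijective
      (mfderiv (𝓡 (2 * Fintype.card (DegIndex n d))) 𝓘(ℝ, DegIndex n d → ℂ) (baseCoordFun n d)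
        (AlgPoints.map (regularFamily ℂ n d) Q)) :=
    bijective_mfderiv_baseCoordFun n d _
  rw [hmf]
  have key : Function.Surjective
      (⇑(mfderiv (𝓡 (2 * Fintype.card (DegIndex n d))) 𝓘(ℝ, DegIndex n d → ℂ) (baseCoordFun n d)
          (AlgPoints.map (regularFamily ℂ n d) Q)) ∘
        ⇑(mfderiv (𝓡 (2 * (n + Fintype.card (DegIndex n d)))) (𝓡 (2 * Fintype.card (DegIndex n d)))
          (AlgPoints.map (regularFamily ℂ n d) : _ → ComplexPoints (affineBase ℂ n d)) Q)) :=
    hbijκ.2.comp hsurjπ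
  exact key

/-! ### §3 The smooth fibres lie in the chart domains' images -/

variable (i : Fin (n + 2))

/-- **Every nonsingular `b` and zero `w` (in the `i`-th affine chart) of `F_b` is attained by a point of `𝒴°(ℂ)ᵢ`**: there is
`Q ∈ 𝒴°(ℂ)ᵢ` with coefficient vector `b` and homogeneous coordinates `[w₀ : … : 1ᵢ : … : w_n]` (`d ≥ 1`).
[cite: VoisinHodgeII2003, §6.2.1] [cite: SerreGAGA1956, §2 n°5] -/
theorem exists_mem_regChartDom_of_eval_eq_zero (hd : 0 < d) {b : DegIndex n d → ℂ}
    (hb : SmoothHypersurface.IsNonsingularForm ℂ (formOfCoeffs b)) {w : Fin (n + 1) → ℂ}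
    (hw : MvPolynomial.eval (Fin.insertNth i (1 : ℂ) w) (formOfCoeffs b) = 0) :
    ∃ Q ∈ regChartDom n d i, regCoeff ℂ n d Q = b ∧
      hypersurfacePoint (regularToProjectiveSpace ℂ n d) Q = Projectivization.stdChartInv i w := by
  set s : ComplexPoints (base ℂ n d) := pointOfCoeffs ℂ n d b hb with hs
  have hform : pointForm ℂ n d s = formOfCoeffs b := pointForm_pointOfCoeffs ℂ n d b hb
  have hℓ : Projectivization.stdChartInv i w ∈ Projectivization.projZeroLocus {pointForm ℂ n d s} := by
    rw [hform, Projectivization.stdChartInv,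
      Projectivization.mem_projZeroLocus_mk_iff (by
        rintro G rfl
        by_cases h0 : formOfCoeffs b = 0
        · rw [h0]; exact MvPolynomial.isHomogeneous_zero _ _ _
        · rw [(isHomogeneous_formOfCoeffs b).totalDegree h0]; exact isHomogeneous_formOfCoeffs b)]
    simpa using hw
  obtain ⟨P, hPs, hPℓ⟩ := exists_point_of_mem_projZeroLocus_pointForm n d hd s hℓ
  refine ⟨AlgPoints.map (totalToRegular ℂ n d) P, ?_, ?_, ?_⟩
  · rw [regChartDom_eq_preimage, Set.mem_preimage, hypersurfacePoint_map_totalToRegular, hPℓ,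
      Projectivization.stdChart_source]
    exact Projectivization.stdChartInv_mem_stdChartSource i w
  · rw [regCoeff_map_totalToRegular, hPs, hs, coeffVector_pointOfCoeffs]
  · rw [hypersurfacePoint_map_totalToRegular, hPℓ]

/-- The same in chart coordinates: the point `Q` of `exists_mem_regChartDom_of_eval_eq_zero` has
`regChartFun n d i Q = ((b_m)_{m ≠ xᵢ^d}, w)`. [cite: VoisinHodgeII2003, §6.2.1] -/
theorem exists_regChartFun_eq (hd : 0 < d) {b : DegIndex n d → ℂ}
    (hb : SmoothHypersurface.IsNonsingularForm ℂ (formOfCoeffs b)) {w : Fin (n + 1) → ℂ}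
    (hw : MvPolynomial.eval (Fin.insertNth i (1 : ℂ) w) (formOfCoeffs b) = 0) :
    ∃ Q ∈ regChartDom n d i, regCoeff ℂ n d Q = b ∧
      regChartFun n d i Q = Sum.elim (fun m => b m.1) w := by
  obtain ⟨Q, hQ, hQb, hQw⟩ := exists_mem_regChartDom_of_eval_eq_zero n d i hd hb hw
  refine ⟨Q, hQ, hQb, ?_⟩
  funext t
  rcases t with m | j
  · change regCoeff ℂ n d Q m.1 = b m.1
    rw [hQb]
  · change Projectivization.stdChart i (hypersurfacePoint (regularToProjectiveSpace ℂ n d) Q) j = w j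
    rw [hQw, Projectivization.stdChart_apply, ← Projectivization.stdChart_symm_apply,
      ← Projectivization.stdChart_apply, (Projectivization.stdChart i).right_inv (by simp)]

end Literature.AlgebraicGeometry.Motives.UniversalHypersurface

end
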